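import Literature.NumberTheory.Irrationality.RhinViola1996.PermutationGroupZeta2
import Literature.NumberTheory.DiophantineApproximation.ViolaZudilinPhiTransformation
import Mathlib.Analysis.Calculus.Deriv.Pi
import Mathlib.MeasureTheory.Function.Jacobian
import HarnessLib

/-!
# Rhin–Viola 1996 (file 2 of 2): `τ`-invariance by the change of variables, and the hypergeometric
# transformation (3.3) — PROVED

Topic `Literature/NumberTheory/Irrationality/RhinViola1996`; companion of `PermutationGroupZeta2.lean` (definitions
`Params`, `square`, `integrand`, `I`, `tau`, `sigma`, `phi`, the citations, and the HONEST FRAMING there: identities of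
double integrals only; nothing about the irrationality or the irrationality measures of `ζ(2)`, `ζ(3)` or `ζ(5)`; records
in print unmoved). Source [RhinViola1996] = G. Rhin, C. Viola, Acta Arith. **77** (1996) 23–56, §2 pp. 27–28
((2.1)–(2.3)) and §3 p. 37 ((3.2)–(3.4)), read on the page.

PROVED here (theorems only; private plumbing, NO definition of content, NO named fact; net debt 0):
* `hypergeometric_phi` — **(3.3)** for admissible parameters ((1.8)–(1.9) non-negative):
  `I(h,i,j,k,l) = h! i!/((i+j−l)! (l+h−j)!) · I(i+j−l, l+h−j, j, k, l)`. The printed route: Euler's exchange (3.2) in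
  the inner `x`-integral for each `y ∈ (0,1)` — the tree's `RhinViola.euler_integral_symm_nat`
  (`DiophantineApproximation/ViolaZudilinPhiTransformation.lean`; Rhin–Viola 2005 (3.3)/(3.4) is the same `₂F₁` symmetry,
  `Hypergeometric.eulerHypergeometric_symm` at natural parameters) — then "multiplying by `y^k(1−y)^j` and integrating
  in `0 ≤ y ≤ 1`" = Tonelli on the open square in `ℝ≥0∞`, so that no finiteness hypothesis is needed.
* `invariance_tau` — **`I(τP) = I(P)`**, `τ(h,i,j,k,l) = (i,j,k,l,h)`, for ALL integer parameters: the birational map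
  `τ : (x,y) ↦ ((1−x)/(1−xy), 1−xy)` maps the open square onto itself with inverse `(ξ,η) ↦ (1−ξη, (1−η)/(1−ξη))`
  (p. 27), its Jacobian determinant is `x/(1−xy) > 0` ("the measure `dx dy/(1−xy)` is invariant"), and
  `x/(1−xy) · F_{τP}(τ(x,y)) = F_P(x,y)` pointwise; then Mathlib's `integral_image_eq_integral_abs_det_fderiv_smul`.
  (A desk pre-check of period, bijection, Jacobian and the pointwise identity in exact rational arithmetic is kept in
  the filing seat's folder.)
* `invariance_word` — every word in `τ, σ` fixes `I` ("the value of `I(h,i,j,k,l)` is invariant under the action of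
  `⟨τ, σ⟩`" `≅ D₅`, p. 28), from `invariance_tau` and `invariance_sigma`.
NOT typed: Theorems 2.1–2.2, 4.1–4.2, 5.1 of the paper (see the companion's module docstring).
-/

noncomputable section

open MeasureTheory Set intervalIntegral
open scoped Nat

namespace Literature.NumberTheory.Irrationality.RhinViola1996

/-- For `x ≤ 1` and `0 < y < 1` the denominator `1 − xy` is positive. [folklore] -/
private theorem den_pos_xy' {x y : ℝ} (hx1 : x ≤ 1) (hy0 : 0 < y) (hy1 : y < 1) : 0 < 1 - x * y := by
  nlinarith [mul_nonneg (sub_nonneg.2 hx1) hy0.le]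

/-! ### §3 (3.3): the integrand with natural exponents and the inner `x`-integral -/

/-- The integrand (2.1) with natural-number exponents as a function of `(x, y)`:
`x^a (1−x)^b y^k (1−y)^j / (1 − xy)^{n+1}` (plumbing for (3.3)). [cite: RhinViola1996, §2 (2.1)] -/
private def rvF (a b k j n : ℕ) (x y : ℝ) : ℝ :=
  x ^ a * (1 - x) ^ b * y ^ k * (1 - y) ^ j / (1 - x * y) ^ (n + 1)

/-- `rvF` is non-negative on `[0,1] × (0,1)`. [folklore] -/
private theorem rvF_nonneg (a b k j n : ℕ) {x y : ℝ} (hx0 : 0 ≤ x) (hx1 : x ≤ 1) (hy0 : 0 < y) (hy1 : y < 1) :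
    0 ≤ rvF a b k j n x y := by
  unfold rvF
  have hD := den_pos_xy' hx1 hy0 hy1
  have h1x : 0 ≤ 1 - x := by linarith
  have h1y : 0 ≤ 1 - y := by linarith
  exact div_nonneg (mul_nonneg (mul_nonneg (mul_nonneg (pow_nonneg hx0 _) (pow_nonneg h1x _))
    (pow_nonneg hy0.le _)) (pow_nonneg h1y _)) (pow_pos hD _).le

/-- `x ↦ rvF … x y` is interval integrable on `[0,1]` for `y ∈ (0,1)`. [folklore] -/
private theorem intervalIntegrable_rvF (a b k j n : ℕ) {y : ℝ} (hy0 : 0 < y) (hy1 : y < 1) :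
    IntervalIntegrable (fun x => rvF a b k j n x y) volume 0 1 := by
  refine ContinuousOn.intervalIntegrable ?_
  unfold rvF
  refine ContinuousOn.div (by fun_prop) (by fun_prop) fun x hx => ?_
  rw [uIcc_of_le zero_le_one, mem_Icc] at hx
  exact (pow_pos (den_pos_xy' hx.2 hy0 hy1) _).ne'

/-- The inner `x`-integral factorises: `∫₀¹ rvF dx = y^k(1−y)^j · ∫₀¹ x^a(1−x)^b/(1−yx)^{n+1} dx`. [folklore] -/
private theorem inner_integral_rvF (a b k j n : ℕ) (y : ℝ) :
    ∫ x in (0:ℝ)..1, rvF a b k j n x y =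
      (y ^ k * (1 - y) ^ j) * ∫ x in (0:ℝ)..1, x ^ a * (1 - x) ^ b / (1 - x * y) ^ (n + 1) := by
  rw [← intervalIntegral.integral_const_mul]
  refine intervalIntegral.integral_congr fun x _ => ?_
  simp only [rvF]
  ring

/-- **The inner identity (the display after (3.2))**: for `y < 1` and `c ≤ a + b`,
`c!(a+b−c)! ∫₀¹ rvF(a,b,k,j;c) dx = a! b! ∫₀¹ rvF(c,a+b−c,k,j;a) dx` — Euler's exchange (3.2) at integer parameters,
which is the tree's `RhinViola.euler_integral_symm_nat` (`DiophantineApproximation/ViolaZudilinPhiTransformation.lean`,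
Rhin–Viola 2005 (3.3)/(3.4) = the same `₂F₁` symmetry), multiplied by `y^k(1−y)^j`.
[cite: RhinViola1996, §3 p. 37 ((3.2) and the display after it)] -/
private theorem inner_exchange (a b c k j : ℕ) (hc : c ≤ a + b) {y : ℝ} (hy1 : y < 1) :
    ((c ! : ℝ) * ((a + b - c) ! : ℝ)) * ∫ x in (0:ℝ)..1, rvF a b k j c x y =
      ((a ! : ℝ) * (b ! : ℝ)) * ∫ x in (0:ℝ)..1, rvF c (a + b - c) k j a x y := by
  rw [inner_integral_rvF a b k j c y, inner_integral_rvF c (a + b - c) k j a y]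
  have hE := DiophantineApproximation.RhinViola.euler_integral_symm_nat (p := a) (r := b) (p' := c)
    (r' := a + b - c) (by omega) hy1
  set K := y ^ k * (1 - y) ^ j
  linear_combination K * hE

/-- `∫⁻` over `(0,1)` of `ofReal ∘ f` is `ofReal` of the interval integral, for `f` interval integrable and
nonnegative on `(0,1)`. [folklore] -/
private theorem setLIntegral_Ioo_ofReal' {f : ℝ → ℝ} (hint : IntervalIntegrable f volume 0 1)
    (hnn : ∀ x ∈ Ioo (0 : ℝ) 1, 0 ≤ f x) :
    ∫⁻ x in Ioo (0 : ℝ) 1, ENNReal.ofReal (f x) = ENNReal.ofReal (∫ x in (0 : ℝ)..1, f x) := by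
  rw [intervalIntegral.integral_of_le zero_le_one, integral_Ioc_eq_integral_Ioo,
    ofReal_integral_eq_lintegral_ofReal]
  · exact (intervalIntegrable_iff_integrableOn_Ioo_of_le zero_le_one).1 hint
  · exact (ae_restrict_iff' measurableSet_Ioo).2 (Filter.Eventually.of_forall hnn)

/-- The inner identity at the level of lower Lebesgue integrals. [cite: RhinViola1996, §3 p. 37 (display after (3.2))] -/
private theorem inner_lintegral_exchange (a b c k j : ℕ) (hc : c ≤ a + b) {y : ℝ} (hy : y ∈ Ioo (0 : ℝ) 1) :
    ∫⁻ x in Ioo (0 : ℝ) 1, ENNReal.ofReal (rvF a b k j c x y) =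
      ENNReal.ofReal (((a ! : ℝ) * (b ! : ℝ)) / ((c ! : ℝ) * ((a + b - c) ! : ℝ))) *
        ∫⁻ x in Ioo (0 : ℝ) 1, ENNReal.ofReal (rvF c (a + b - c) k j a x y) := by
  rw [setLIntegral_Ioo_ofReal' (intervalIntegrable_rvF a b k j c hy.1 hy.2)
      (fun x hx => rvF_nonneg a b k j c hx.1.le hx.2.le hy.1 hy.2),
    setLIntegral_Ioo_ofReal' (intervalIntegrable_rvF c (a + b - c) k j a hy.1 hy.2)
      (fun x hx => rvF_nonneg c (a + b - c) k j a hx.1.le hx.2.le hy.1 hy.2),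
    ← ENNReal.ofReal_mul (by positivity)]
  congr 1
  have hE := inner_exchange a b c k j hc hy.2
  have hcd : ((c ! : ℝ) * ((a + b - c) ! : ℝ)) ≠ 0 := by positivity
  field_simp
  linear_combination hE

/-! ### Tonelli on the square ("multiplying by `y^k(1−y)^j` and integrating in `0 ≤ y ≤ 1`") -/

/-- Iterated-integral (Tonelli) form of a lower Lebesgue integral over `Fin 2 → ℝ` against a product measure, with
the first coordinate innermost. [folklore] -/
private theorem lintegral_pi_fin_two_x_inner (ν : Measure ℝ) [SigmaFinite ν]
    {f : (Fin 2 → ℝ) → ENNReal} (hf : Measurable f) :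
    ∫⁻ p, f p ∂Measure.pi (fun _ : Fin 2 => ν) = ∫⁻ y, ∫⁻ x, f ![x, y] ∂ν ∂ν := by
  rw [lintegral_eq_lmarginal_univ (fun _ => (0 : ℝ))]
  have huniv : (Finset.univ : Finset (Fin 2)) = {1, 0} := by
    ext i; fin_cases i <;> simp
  rw [huniv, lmarginal_insert f hf (i := (1 : Fin 2)) (s := {0}) (by decide)]
  refine lintegral_congr fun y => ?_
  rw [lmarginal_singleton]
  refine lintegral_congr fun x => ?_
  congr 1
  ext i; fin_cases i <;> simp

/-- `rvF` read on a point of `ℝ²` is measurable (after `ENNReal.ofReal`). [folklore] -/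
private theorem measurable_ofReal_rvF (a b k j n : ℕ) :
    Measurable fun p : Fin 2 → ℝ => ENNReal.ofReal (rvF a b k j n (p 0) (p 1)) := by
  unfold rvF
  fun_prop

/-- **The square identity**: `∫⁻_{(0,1)²} rvF(a,b,k,j;c) = (a!b!/(c!(a+b−c)!)) ∫⁻_{(0,1)²} rvF(c,a+b−c,k,j;a)`.
[cite: RhinViola1996, §3 (3.3), p. 37] -/
private theorem square_lintegral_exchange (a b c k j : ℕ) (hc : c ≤ a + b) :
    ∫⁻ p in square, ENNReal.ofReal (rvF a b k j c (p 0) (p 1)) =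
      ENNReal.ofReal (((a ! : ℝ) * (b ! : ℝ)) / ((c ! : ℝ) * ((a + b - c) ! : ℝ))) *
        ∫⁻ p in square, ENNReal.ofReal (rvF c (a + b - c) k j a (p 0) (p 1)) := by
  have hS : square = Set.pi univ (fun _ => Ioo (0 : ℝ) 1) := by
    ext p; simp [square]
  have hrestrict : (volume : Measure (Fin 2 → ℝ)).restrict square
      = Measure.pi (fun _ : Fin 2 => (volume : Measure ℝ).restrict (Ioo (0 : ℝ) 1)) := by
    rw [hS, volume_pi, Measure.restrict_pi_pi]
  rw [hrestrict, lintegral_pi_fin_two_x_inner _ (measurable_ofReal_rvF a b k j c),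
    lintegral_pi_fin_two_x_inner _ (measurable_ofReal_rvF c (a + b - c) k j a)]
  simp only [Matrix.cons_val_zero, Matrix.cons_val_one]
  rw [← lintegral_const_mul' _ _ ENNReal.ofReal_ne_top]
  refine setLIntegral_congr_fun measurableSet_Ioo fun y hy => ?_
  exact inner_lintegral_exchange a b c k j hc hy

/-- The Bochner integral of `rvF` over the square is the real part of the lower Lebesgue integral. [folklore] -/
private theorem integral_square_rvF (a b k j n : ℕ) :
    ∫ p in square, rvF a b k j n (p 0) (p 1) =
      (∫⁻ p in square, ENNReal.ofReal (rvF a b k j n (p 0) (p 1))).toReal := by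
  have hnn : 0 ≤ᵐ[volume.restrict square] fun p : Fin 2 → ℝ => rvF a b k j n (p 0) (p 1) := by
    filter_upwards [ae_restrict_mem measurableSet_square] with p hp
    have h0 := hp 0
    have h1 := hp 1
    simp only [mem_Ioo] at h0 h1
    exact rvF_nonneg a b k j n h0.1.le h0.2.le h1.1 h1.2
  have hmeas : AEStronglyMeasurable (fun p : Fin 2 → ℝ => rvF a b k j n (p 0) (p 1))
      (volume.restrict square) := by
    refine (show Measurable _ by unfold rvF; fun_prop).aestronglyMeasurable
  exact integral_eq_lintegral_of_nonneg_ae hnn hmeas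

/-- **The hypergeometric transformation (3.3) — PROVED**: for admissible parameters ((1.8)–(1.9)),
`I(h,i,j,k,l) = h! i!/((i+j−l)! (l+h−j)!) · I(i+j−l, l+h−j, j, k, l)`, i.e. `I(P)/(h!i!) = I(φP)/((i+j−l)!(l+h−j)!)`, by
Euler's exchange (3.2) in the variable `x` (`w = y`) and Tonelli on the square; no convergence hypothesis is used.
[cite: RhinViola1996, §3 (3.3), p. 37] -/
theorem hypergeometric_phi {P : Params} (hP : P.Admissible) :
    I P = ((Nat.factorial P.h.toNat * Nat.factorial P.i.toNat : ℕ) : ℝ) /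
        ((Nat.factorial (P.i + P.j - P.l).toNat * Nat.factorial (P.l + P.h - P.j).toNat : ℕ) : ℝ) * I (phi P) := by
  obtain ⟨hnn, haux⟩ := hP
  obtain ⟨h, i, j, k, l⟩ := P
  simp only [Params.Nonneg, Params.aux] at hnn haux
  obtain ⟨h0, i0, j0, k0, l0⟩ := hnn
  obtain ⟨-, -, alh0, -, aij0⟩ := haux
  obtain ⟨a, rfl⟩ := Int.eq_ofNat_of_zero_le h0
  obtain ⟨b, rfl⟩ := Int.eq_ofNat_of_zero_le i0
  obtain ⟨jj, rfl⟩ := Int.eq_ofNat_of_zero_le j0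
  obtain ⟨kk, rfl⟩ := Int.eq_ofNat_of_zero_le k0
  obtain ⟨ll, rfl⟩ := Int.eq_ofNat_of_zero_le l0
  set c : ℕ := b + jj - ll with hcdef
  have hc : c ≤ a + b := by omega
  have ec : (b : ℤ) + jj - ll = (c : ℤ) := by omega
  have ed : (ll : ℤ) + a - jj = ((a + b - c : ℕ) : ℤ) := by omega
  have hIP : integrand ⟨a, b, jj, kk, ll⟩ = fun p => rvF a b kk jj c (p 0) (p 1) := by
    funext p
    have e : (b : ℤ) + jj - ll + 1 = ((c + 1 : ℕ) : ℤ) := by omega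
    simp only [integrand, rvF, e, zpow_natCast]
  have hIphi : integrand (phi ⟨a, b, jj, kk, ll⟩) = fun p => rvF c (a + b - c) kk jj a (p 0) (p 1) := by
    funext p
    have e : ((ll : ℤ) + a - jj) + jj - ll + 1 = ((a + 1 : ℕ) : ℤ) := by omega
    simp only [integrand, phi, rvF]
    rw [e, ec, ed]
    simp only [zpow_natCast]
  have hfa : (a : ℤ).toNat = a := Int.toNat_natCast a
  have hfb : (b : ℤ).toNat = b := Int.toNat_natCast b
  have hfc : ((b : ℤ) + jj - ll).toNat = c := by rw [ec, Int.toNat_natCast]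
  have hfd : ((ll : ℤ) + a - jj).toNat = a + b - c := by rw [ed, Int.toNat_natCast]
  simp only [hfa, hfb, hfc, hfd, I]
  rw [hIP, hIphi, integral_square_rvF, integral_square_rvF, square_lintegral_exchange a b c kk jj hc,
    ENNReal.toReal_mul, ENNReal.toReal_ofReal (by positivity)]
  push_cast
  ring

/-! ### `τ`: the birational map of period 5 (p. 27) -/

/-- `τ : (x, y) ↦ (ξ, η) = ((1−x)/(1−xy), 1−xy)` (plumbing for `invariance_tau`). [cite: RhinViola1996, §2 p. 27 (definition of τ)] -/
private def tauMap (p : Fin 2 → ℝ) : Fin 2 → ℝ := ![(1 - p 0) / (1 - p 0 * p 1), 1 - p 0 * p 1]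

/-- `τ⁻¹ : (ξ, η) ↦ (x, y) = (1 − ξη, (1−η)/(1−ξη))`. [cite: RhinViola1996, §2 p. 27 (the change of variables τ⁻¹)] -/
private def tauInv (p : Fin 2 → ℝ) : Fin 2 → ℝ := ![1 - p 0 * p 1, (1 - p 1) / (1 - p 0 * p 1)]

/-- `ξ = (1−x)/(1−xy)`. [cite: RhinViola1996, §2 p. 27] -/
private theorem tauMap_zero (p : Fin 2 → ℝ) : tauMap p 0 = (1 - p 0) / (1 - p 0 * p 1) := rfl
/-- `η = 1 − xy`. [cite: RhinViola1996, §2 p. 27] -/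
private theorem tauMap_one (p : Fin 2 → ℝ) : tauMap p 1 = 1 - p 0 * p 1 := rfl
/-- `x = 1 − ξη`. [cite: RhinViola1996, §2 p. 27] -/
private theorem tauInv_zero (p : Fin 2 → ℝ) : tauInv p 0 = 1 - p 0 * p 1 := rfl
/-- `y = (1−η)/(1−ξη)`. [cite: RhinViola1996, §2 p. 27] -/
private theorem tauInv_one (p : Fin 2 → ℝ) : tauInv p 1 = (1 - p 1) / (1 - p 0 * p 1) := rfl

/-- On the open square `0 < 1 − xy`. [folklore] -/
private theorem W_pos {p : Fin 2 → ℝ} (hp : p ∈ square) : 0 < 1 - p 0 * p 1 :=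
  den_pos_xy' (hp 0).2.le (hp 1).1 (hp 1).2

/-- "`τ` … maps the unit square `(0,1) × (0,1)` onto itself": `τ` maps the open square into itself.
[cite: RhinViola1996, §2 p. 27] -/
private theorem tauMap_mem_square {p : Fin 2 → ℝ} (hp : p ∈ square) : tauMap p ∈ square := by
  have hx := hp 0
  have hy := hp 1
  have hW := W_pos hp
  intro i
  fin_cases i
  · show tauMap p 0 ∈ Ioo (0:ℝ) 1
    rw [tauMap_zero]
    refine ⟨div_pos (sub_pos.2 hx.2) hW, ?_⟩
    rw [div_lt_one hW]
    nlinarith [mul_pos hx.1 (sub_pos.2 hy.2)]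
  · show tauMap p 1 ∈ Ioo (0:ℝ) 1
    rw [tauMap_one]
    exact ⟨hW, by nlinarith [mul_pos hx.1 hy.1]⟩

/-- `τ⁻¹` maps the open square into itself. [cite: RhinViola1996, §2 p. 27] -/
private theorem tauInv_mem_square {p : Fin 2 → ℝ} (hp : p ∈ square) : tauInv p ∈ square := by
  have hx := hp 0
  have hy := hp 1
  have hW := W_pos hp
  intro i
  fin_cases i
  · show tauInv p 0 ∈ Ioo (0:ℝ) 1
    rw [tauInv_zero]
    exact ⟨hW, by nlinarith [mul_pos hx.1 hy.1]⟩
  · show tauInv p 1 ∈ Ioo (0:ℝ) 1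
    rw [tauInv_one]
    refine ⟨div_pos (sub_pos.2 hy.2) hW, ?_⟩
    rw [div_lt_one hW]
    nlinarith [mul_pos (sub_pos.2 hx.2) hy.1]

/-- `τ⁻¹ ∘ τ = id` on the open square. [cite: RhinViola1996, §2 p. 27] -/
private theorem tauInv_tauMap {p : Fin 2 → ℝ} (hp : p ∈ square) : tauInv (tauMap p) = p := by
  have hx0 : p 0 ≠ 0 := (hp 0).1.ne'
  have hW : 1 - p 0 * p 1 ≠ 0 := (W_pos hp).ne'
  have e : 1 - tauMap p 0 * tauMap p 1 = p 0 := by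
    rw [tauMap_zero, tauMap_one, div_mul_cancel₀ _ hW]; ring
  funext i
  fin_cases i
  · show tauInv (tauMap p) 0 = p 0
    rw [tauInv_zero, e]
  · show tauInv (tauMap p) 1 = p 1
    rw [tauInv_one, e, tauMap_one, div_eq_iff hx0]; ring

/-- `τ ∘ τ⁻¹ = id` on the open square. [cite: RhinViola1996, §2 p. 27] -/
private theorem tauMap_tauInv {p : Fin 2 → ℝ} (hp : p ∈ square) : tauMap (tauInv p) = p := by
  have hy0 : p 1 ≠ 0 := (hp 1).1.ne'
  have hW : 1 - p 0 * p 1 ≠ 0 := (W_pos hp).ne'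
  have e : 1 - tauInv p 0 * tauInv p 1 = p 1 := by
    rw [tauInv_zero, tauInv_one, mul_div_assoc', mul_div_cancel_left₀ _ hW]; ring
  funext i
  fin_cases i
  · show tauMap (tauInv p) 0 = p 0
    rw [tauMap_zero, e, tauInv_zero, div_eq_iff hy0]; ring
  · show tauMap (tauInv p) 1 = p 1
    rw [tauMap_one, e]

/-- `τ` is injective on the open square. [cite: RhinViola1996, §2 p. 27] -/
private theorem tauMap_injOn : InjOn tauMap square := fun p hp q hq h => by
  rw [← tauInv_tauMap hp, ← tauInv_tauMap hq, h]

/-- "`τ` … maps the unit square onto itself". [cite: RhinViola1996, §2 p. 27] -/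
private theorem tauMap_image_square : tauMap '' square = square := by
  ext q
  constructor
  · rintro ⟨p, hp, rfl⟩
    exact tauMap_mem_square hp
  · intro hq
    exact ⟨tauInv q, tauInv_mem_square hq, tauMap_tauInv hq⟩

/-! ### The Jacobian of `τ`: `|det Dτ| = x/(1−xy)` ("the measure `dx dy/(1−xy)` is invariant") -/

/-- The components of `τ` are differentiable at points of the open square. [folklore] -/
private theorem differentiableAt_tauMap_apply {p : Fin 2 → ℝ} (hp : p ∈ square) (i : Fin 2) :
    DifferentiableAt ℝ (fun q => tauMap q i) p := by
  have hW := (W_pos hp).ne'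
  fin_cases i
  · show DifferentiableAt ℝ (fun q => tauMap q 0) p
    simp only [tauMap_zero]
    fun_prop (disch := exact hW)
  · show DifferentiableAt ℝ (fun q => tauMap q 1) p
    simp only [tauMap_one]; fun_prop

/-- The derivative of `τ` at `p`. [folklore] -/
private def tauDeriv (p : Fin 2 → ℝ) : (Fin 2 → ℝ) →L[ℝ] (Fin 2 → ℝ) :=
  ContinuousLinearMap.pi fun i : Fin 2 => fderiv ℝ (fun q => tauMap q i) p

/-- `τ` is differentiable at points of the open square, with derivative `tauDeriv`. [folklore] -/
private theorem hasFDerivAt_tauMap {p : Fin 2 → ℝ} (hp : p ∈ square) : HasFDerivAt tauMap (tauDeriv p) p := by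
  show HasFDerivAt (fun q i => (fun (i : Fin 2) (q : Fin 2 → ℝ) => tauMap q i) i q)
    (ContinuousLinearMap.pi fun i : Fin 2 => fderiv ℝ (fun q => tauMap q i) p) p
  exact hasFDerivAt_pi.2 fun i => (differentiableAt_tauMap_apply hp i).hasFDerivAt

/-- A partial derivative of a component of `τ` as an ordinary derivative along a coordinate line. [folklore] -/
private theorem tauDeriv_entry {p : Fin 2 → ℝ} (hp : p ∈ square) (i j : Fin 2) {g : ℝ → ℝ} {d : ℝ}
    (hd : HasDerivAt g d (p j)) (hg : ∀ t, tauMap (Function.update p j t) i = g t) :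
    fderiv ℝ (fun q => tauMap q i) p (Pi.single j 1) = d := by
  have hl : HasFDerivAt (fun q => tauMap q i) (fderiv ℝ (fun q => tauMap q i) p)
      (Function.update p j (p j)) := by
    rw [Function.update_eq_self]; exact (differentiableAt_tauMap_apply hp i).hasFDerivAt
  have hcomp := hl.comp_hasDerivAt (p j) (hasDerivAt_update p j (p j))
  have hfun : (fun q => tauMap q i) ∘ Function.update p j = g := funext fun t => hg t
  rw [hfun] at hcomp
  exact hcomp.unique hd

/-- `∂ξ/∂x = −(1−y)/(1−xy)²`. [folklore] -/
private theorem tau_entry00 {p : Fin 2 → ℝ} (hp : p ∈ square) :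
    fderiv ℝ (fun q => tauMap q 0) p (Pi.single 0 1) = -(1 - p 1) / (1 - p 0 * p 1) ^ 2 := by
  have hW := (W_pos hp).ne'
  refine tauDeriv_entry hp 0 0 (g := fun t => (1 - t) / (1 - t * p 1)) ?_ fun t => by simp [tauMap_zero]
  have h1 : HasDerivAt (fun t => 1 - t) (-1) (p 0) := by
    have h := (hasDerivAt_id' (p 0)).const_sub 1
    exact h.congr_deriv (by ring)
  have h2 : HasDerivAt (fun t => 1 - t * p 1) (-p 1) (p 0) := by
    have h := ((hasDerivAt_id' (p 0)).mul_const (p 1)).const_sub 1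
    exact h.congr_deriv (by ring)
  have h := h1.div h2 hW
  refine h.congr_deriv ?_
  field_simp
  ring

/-- `∂ξ/∂y = x(1−x)/(1−xy)²`. [folklore] -/
private theorem tau_entry01 {p : Fin 2 → ℝ} (hp : p ∈ square) :
    fderiv ℝ (fun q => tauMap q 0) p (Pi.single 1 1) = p 0 * (1 - p 0) / (1 - p 0 * p 1) ^ 2 := by
  have hW := (W_pos hp).ne'
  refine tauDeriv_entry hp 0 1 (g := fun t => (1 - p 0) / (1 - p 0 * t)) ?_ fun t => by simp [tauMap_zero]
  have h2 : HasDerivAt (fun t => 1 - p 0 * t) (-p 0) (p 1) := by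
    have h := ((hasDerivAt_id' (p 1)).const_mul (p 0)).const_sub 1
    exact h.congr_deriv (by ring)
  have h := (hasDerivAt_const (p 1) (1 - p 0)).div h2 hW
  refine h.congr_deriv ?_
  field_simp
  ring

/-- `∂η/∂x = −y`. [folklore] -/
private theorem tau_entry10 {p : Fin 2 → ℝ} (hp : p ∈ square) :
    fderiv ℝ (fun q => tauMap q 1) p (Pi.single 0 1) = -p 1 := by
  refine tauDeriv_entry hp 1 0 (g := fun t => 1 - t * p 1) ?_ fun t => by simp [tauMap_one]
  have h := ((hasDerivAt_id' (p 0)).mul_const (p 1)).const_sub 1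
  exact h.congr_deriv (by ring)

/-- `∂η/∂y = −x`. [folklore] -/
private theorem tau_entry11 {p : Fin 2 → ℝ} (hp : p ∈ square) :
    fderiv ℝ (fun q => tauMap q 1) p (Pi.single 1 1) = -p 0 := by
  refine tauDeriv_entry hp 1 1 (g := fun t => 1 - p 0 * t) ?_ fun t => by simp [tauMap_one]
  have h := ((hasDerivAt_id' (p 1)).const_mul (p 0)).const_sub 1
  exact h.congr_deriv (by ring)

/-- `det Dτ = x/(1−xy)` on the open square. [cite: RhinViola1996, §2 p. 27 ("the measure dx dy/(1−xy) [is] invariant")] -/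
private theorem det_tauDeriv {p : Fin 2 → ℝ} (hp : p ∈ square) : (tauDeriv p).det = p 0 / (1 - p 0 * p 1) := by
  have hW := (W_pos hp).ne'
  show LinearMap.det ((tauDeriv p : (Fin 2 → ℝ) →L[ℝ] (Fin 2 → ℝ)) : (Fin 2 → ℝ) →ₗ[ℝ] (Fin 2 → ℝ)) = _
  rw [← LinearMap.det_toMatrix']
  have hM : ∀ i j, LinearMap.toMatrix' ((tauDeriv p : _ →L[ℝ] _) : (Fin 2 → ℝ) →ₗ[ℝ] (Fin 2 → ℝ)) i j =
      fderiv ℝ (fun q => tauMap q i) p (Pi.single j 1) := by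
    intro i j
    rw [LinearMap.toMatrix'_apply, ContinuousLinearMap.coe_coe]
    simp [tauDeriv]
  rw [Matrix.det_fin_two]
  simp only [hM, tau_entry00 hp, tau_entry01 hp, tau_entry10 hp, tau_entry11 hp]
  set x := p 0
  set y := p 1
  set W := 1 - x * y with hWdef
  rw [eq_div_iff hW]
  have hW2 : W ^ 2 ≠ 0 := pow_ne_zero 2 hW
  have e1 : -(1 - y) / W ^ 2 * -x - x * (1 - x) / W ^ 2 * -y = x * W / W ^ 2 := by
    rw [div_mul_eq_mul_div, div_mul_eq_mul_div, ← sub_div, hWdef]; ring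
  rw [e1, div_mul_eq_mul_div, div_eq_iff hW2]; ring

/-- `|det Dτ| = x/(1−xy)`. [cite: RhinViola1996, §2 p. 27] -/
private theorem abs_det_tauDeriv {p : Fin 2 → ℝ} (hp : p ∈ square) : |(tauDeriv p).det| = p 0 / (1 - p 0 * p 1) := by
  rw [det_tauDeriv hp, abs_of_pos (div_pos (hp 0).1 (W_pos hp))]

/-! ### The integrand under `τ` and the invariance -/

/-- A positive real to an integer power as an exponential. [folklore] -/
private theorem zpow_eq_exp {t : ℝ} (ht : 0 < t) (n : ℤ) : t ^ n = Real.exp (n * Real.log t) := by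
  rw [← Real.rpow_intCast, Real.rpow_def_of_pos ht, mul_comm]

/-- The pointwise identity behind `invariance_tau`: `|det Dτ(u)| · F_{τP}(τu) = F_P(u)` on the open square
("the function `x(1−x)y(1−y)/(1−xy)` and the measure `dx dy/(1−xy)` are invariant under the action of `τ`"); it holds
for all integer parameters. [cite: RhinViola1996, §2 p. 27] -/
private theorem integrand_tau (P : Params) {p : Fin 2 → ℝ} (hp : p ∈ square) :
    p 0 / (1 - p 0 * p 1) * integrand (tau P) (tauMap p) = integrand P p := by
  have hx := hp 0
  have hy := hp 1
  simp only [integrand, tau]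
  have eX : tauMap p 0 = (1 - p 0) / (1 - p 0 * p 1) := rfl
  have eY : tauMap p 1 = 1 - p 0 * p 1 := rfl
  rw [eX, eY]
  set x := p 0 with hxdef
  set y := p 1 with hydef
  set W := 1 - x * y with hWdef
  have hx0 : 0 < x := hx.1
  have hy0 : 0 < y := hy.1
  have hW : 0 < W := W_pos hp
  have e1X : 1 - (1 - x) / W = x * (1 - y) / W := by
    rw [eq_div_iff hW.ne', sub_mul, div_mul_cancel₀ _ hW.ne', hWdef]; ring
  have e1Y : 1 - W = x * y := by rw [hWdef]; ring
  have eD : 1 - (1 - x) / W * W = x := by rw [div_mul_cancel₀ _ hW.ne']; ring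
  rw [eD, e1X, e1Y]
  set x1 := 1 - x with hx1def
  set y1 := 1 - y with hy1def
  have hx1 : 0 < x1 := sub_pos.2 hx.2
  have hy1 : 0 < y1 := sub_pos.2 hy.2
  have hJ : x / W = Real.exp (Real.log x - Real.log W) := by
    rw [Real.exp_sub, Real.exp_log hx0, Real.exp_log hW]
  rw [hJ]
  simp only [mul_zpow, div_zpow]
  simp only [zpow_eq_exp hx0, zpow_eq_exp hx1, zpow_eq_exp hy0, zpow_eq_exp hy1, zpow_eq_exp hW]
  simp only [← Real.exp_add, ← Real.exp_sub]
  rw [Real.exp_eq_exp]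
  push_cast
  ring

/-- **Invariance under `τ` — PROVED**: `I(i,j,k,l,h) = I(h,i,j,k,l)` for ALL integer parameters, by the change of
variables `τ` (period 5) in the double integral: Mathlib's `integral_image_eq_integral_abs_det_fderiv_smul` on the open
square with `|det Dτ| = x/(1−xy)`, and `integrand_tau`. (The paper states it for non-negative parameters, where the
integrals are finite; as an identity of Bochner integrals it holds unconditionally.)
[cite: RhinViola1996, §2 pp. 27–28 ((2.2)–(2.3), "the value of I(h,i,j,k,l) is invariant under the action of ⟨τ, σ⟩")] -/
theorem invariance_tau (P : Params) : I (tau P) = I P := by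
  have hderiv : ∀ p ∈ square, HasFDerivWithinAt tauMap (tauDeriv p) square p :=
    fun p hp => (hasFDerivAt_tauMap hp).hasFDerivWithinAt
  have hI := integral_image_eq_integral_abs_det_fderiv_smul volume measurableSet_square hderiv tauMap_injOn
    (integrand (tau P))
  rw [tauMap_image_square] at hI
  unfold I
  rw [hI]
  refine setIntegral_congr_fun measurableSet_square fun p hp => ?_
  rw [smul_eq_mul, abs_det_tauDeriv hp]
  exact integrand_tau P hp

/-- The dihedral group `⟨τ, σ⟩ ≅ D₅` acts on the integrals: for every word in `τ, σ`, `I` is unchanged — here as the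
closure property for the two generators (`invariance_tau`, `invariance_sigma`) applied to any list of generators
(`true` = `τ`, `false` = `σ`). [cite: RhinViola1996, §2 p. 28] -/
theorem invariance_word (w : List Bool) (P : Params) :
    I (w.foldr (fun b Q => if b then tau Q else sigma Q) P) = I P := by
  induction w with
  | nil => rfl
  | cons b w ih =>
    simp only [List.foldr]
    split_ifs
    · rw [invariance_tau, ih]
    · rw [invariance_sigma, ih]

end Literature.NumberTheory.Irrationality.RhinViola1996

end
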